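import Summits.ValiantsHypothesis.ValiantsHypothesis.Theorems.LangWeilTransferTameTransferModelKernel
import Literature.RingTheory.NoetherNormalization.HypersurfaceModel
import Literature.AlgebraicGeometry.Motives.CurveThroughTwoPointsHypersurfaceModel

/-!
# LangWeilTransfer, crux `TameTransfer` (stmt-ValiantsHypothesis-6373) — step (C), point
# condition: zeros of the model off `ρ = 0` map into `V(𝔭)`

Route `LangWeilTransfer` of `ValiantsHypothesis`; Theorem T (`TameTransfer`) closes BY NAME from
`TameResolution` (stmt-6378). In the situation of `LangWeilTransferTameTransferModelKernel`
(prime `P ⊆ k[Y₁..Y_m]`, Noether coordinates `ℓ` algebraically independent modulo `P`, `u ∈ k[Y]`,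
irreducible `Q ∈ k[X₀, …, X_r]` with constant leading `X₀`-coefficient and `Q(u, ℓ) ∈ P`), suppose
a parametrisation is given by CONGRUENCES modulo `P`:

  `ρ(ℓ) · Y_j ≡ V_j(u, ℓ)  (mod P)`   for all `j`, with `ρ ∈ k[X₁..X_r]`, `ρ ≠ 0`, `V_j ∈ k[X₀..X_r]`.

Then (`aeval_div_eq_zero_of_congruence`) for every field `L ⊇ k`, every `x ∈ L^{r+1}` with
`Q(x) = 0` and `ρ(x₁, …, x_r) ≠ 0`, and every `g ∈ P`:

  `g(V₁(x)/ρ(x'), …, V_m(x)/ρ(x')) = 0`,   `x' = (x₁, …, x_r)`,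

which is the point conjunct of `TameResolution`
(`∀ x, Q(x) = 0 → ρ(x ∘ succ) ≠ 0 → ∀ i, S_i(V(x)/ρ(x ∘ succ)) = 0`, as `S_i ∈ (S) ⊆ 𝔭`); the
version for INTEGER data `Q, ρ, V, S` read over `ℚ` and evaluated over `ℚ̄`, literally in the
route's shape, is `forall_aeval_div_eq_zero_int`.
Proof: the weighted homogenisation `H = ρ^{deg g} g(V/ρ) ∈ k[X₁..X_r][X₀]` (tree
`Literature.RingTheory.NoetherNormalization.homog` / `map_homog_eq_of_mul_eq`) maps to
`ρ(ℓ)^N g(Y) = 0` in `Frac(k[Y]/P)`, so `H` lies in the kernel of the substitution, which is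
`(Q)` (`comap_aeval_cons_eq_span_singleton_of_leadingCoeff_eq_C`); hence `H(x) = 0`, and
`map_homog_eq` at `x` divides out `ρ(x')^N ≠ 0`. No inverse isomorphism is used.

Honest framing: helper `--supports` an open crux of a conditional route; VP ≠ VNP is NOT proved and
nothing here bears on it.
-/

noncomputable section

open MvPolynomial Polynomial

-- the summit and the problem share the name `ValiantsHypothesis` (D-0017 single-conjunct layout)
set_option linter.dupNamespace false

namespace Summit.ValiantsHypothesis.ValiantsHypothesis.Theorems.LangWeilTransfer

open Literature.RingTheory.MvPolynomial
open Literature.RingTheory.NoetherNormalization (homog map_homog_eq map_homog_eq_of_mul_eq)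
open Literature.AlgebraicGeometry.Motives.TwoPointPencil (aeval_cons_eq_aevalTower)

section Points

variable {k : Type*} [Field k] {m r : ℕ}

/-- Evaluation of `finSuccEquiv p` at a point `x ∈ L^{r+1}` through `aevalTower`:
`(aevalTower (aeval (x ∘ succ)) (x 0)) (finSuccEquiv p) = p(x)`. -/
theorem aevalTower_finSuccEquiv {L : Type*} [CommRing L] [Algebra k L] (x : Fin (r + 1) → L)
    (p : MvPolynomial (Fin (r + 1)) k) :
    Polynomial.aevalTower (MvPolynomial.aeval (x ∘ Fin.succ) : MvPolynomial (Fin r) k →ₐ[k] L)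
        (x 0) (finSuccEquiv k r p) = MvPolynomial.aeval x p := by
  have hx : (Fin.cons (x 0) (x ∘ Fin.succ) : Fin (r + 1) → L) = x := Fin.cons_self_tail x
  rw [← aeval_cons_eq_aevalTower (x ∘ Fin.succ) (x 0) p, hx]

/-- **The point condition of the resolution from congruences.** Let `P ⊆ k[Y₁..Y_m]` be prime,
`ℓ : Fin r → k[Y]` algebraically independent modulo `P`, `u ∈ k[Y]`, `Q ∈ k[X₀..X_r]` irreducible
with `(finSuccEquiv Q).leadingCoeff = C c`, `c ≠ 0`, and `Q(u, ℓ) ∈ P`; let `ρ ∈ k[X₁..X_r]`,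
`ρ ≠ 0`, and `V : Fin m → k[X₀..X_r]` satisfy the congruences `ρ(ℓ)·Y_j - V_j(u, ℓ) ∈ P`. Then
for every field `L ⊇ k`, every `x ∈ L^{r+1}` with `Q(x) = 0`, `ρ(x ∘ succ) ≠ 0`, and every
`g ∈ P`: `g(V(x)/ρ(x ∘ succ)) = 0`. -/
theorem aeval_div_eq_zero_of_congruence (P : Ideal (MvPolynomial (Fin m) k)) [P.IsPrime]
    (ℓ : Fin r → MvPolynomial (Fin m) k) (u : MvPolynomial (Fin m) k)
    (hind : AlgebraicIndependent k fun i => Ideal.Quotient.mk P (ℓ i))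
    (Q : MvPolynomial (Fin (r + 1)) k) {c : k} (hc : c ≠ 0)
    (hlc : (finSuccEquiv k r Q).leadingCoeff = MvPolynomial.C c) (hirr : Irreducible Q)
    (hroot : MvPolynomial.aeval (Fin.cons u ℓ : Fin (r + 1) → MvPolynomial (Fin m) k) Q ∈ P)
    (ρ : MvPolynomial (Fin r) k) (hρ : ρ ≠ 0) (V : Fin m → MvPolynomial (Fin (r + 1)) k)
    (hV : ∀ j, MvPolynomial.aeval ℓ ρ * X j -
      MvPolynomial.aeval (Fin.cons u ℓ : Fin (r + 1) → MvPolynomial (Fin m) k) (V j) ∈ P)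
    {g : MvPolynomial (Fin m) k} (hg : g ∈ P)
    {L : Type*} [Field L] [Algebra k L] (x : Fin (r + 1) → L)
    (hQx : MvPolynomial.aeval x Q = 0) (hρx : MvPolynomial.aeval (x ∘ Fin.succ) ρ ≠ 0) :
    MvPolynomial.aeval (fun j => MvPolynomial.aeval x (V j) / MvPolynomial.aeval (x ∘ Fin.succ) ρ) g
      = 0 := by
  classical
  -- the algebra `B = k[Y]/P` over `A = k[X₁..X_r]` through `ℓ`, and its fraction field `F`
  letI inst : Algebra (MvPolynomial (Fin r) k) (MvPolynomial (Fin m) k ⧸ P) :=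
    ((MvPolynomial.aeval fun i => Ideal.Quotient.mk P (ℓ i)) :
      MvPolynomial (Fin r) k →ₐ[k] MvPolynomial (Fin m) k ⧸ P).toRingHom.toAlgebra
  letI instM : Module (MvPolynomial (Fin r) k) (MvPolynomial (Fin m) k ⧸ P) := Algebra.toModule
  haveI : IsDomain (MvPolynomial (Fin m) k ⧸ P) :=
    (Ideal.Quotient.isDomain_iff_prime P).mpr inferInstance
  have hcompat := aeval_finSuccEquiv_eq_mk_aeval_cons P ℓ u
  -- the homogenisation `H = ρ^N g(w/ρ)` with `w_j = finSuccEquiv (V j)`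
  set w : Fin m → (MvPolynomial (Fin r) k)[X] := fun j => finSuccEquiv k r (V j) with hw
  set H : (MvPolynomial (Fin r) k)[X] := homog ρ w g with hH
  -- (1) `H` maps to `0` in `F = Frac(k[Y]/P)`
  set B := MvPolynomial (Fin m) k ⧸ P
  set F := FractionRing (MvPolynomial (Fin m) k ⧸ P)
  let θ : (MvPolynomial (Fin r) k)[X] →ₐ[MvPolynomial (Fin r) k] B :=
    Polynomial.aeval (Ideal.Quotient.mk P u)
  let φ : (MvPolynomial (Fin r) k)[X] →+* F := (algebraMap B F).comp θ.toRingHom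
  have hφC : ∀ a : MvPolynomial (Fin r) k, φ (Polynomial.C a) =
      algebraMap B F (Ideal.Quotient.mk P (MvPolynomial.aeval ℓ a)) := by
    intro a
    change algebraMap B F (θ (Polynomial.C a)) = _
    rw [Polynomial.aeval_C, RingHom.algebraMap_toAlgebra, AlgHom.toRingHom_eq_coe,
      AlgHom.coe_toRingHom]
    congr 1
    -- `aeval (mk ∘ ℓ) a = mk (aeval ℓ a)`
    have : (MvPolynomial.aeval fun i => Ideal.Quotient.mk P (ℓ i)) =
        (Ideal.Quotient.mkₐ k P).comp (MvPolynomial.aeval ℓ) := by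
      rw [MvPolynomial.comp_aeval]
      rfl
    rw [this]
    rfl
  have hφw : ∀ j, φ (w j) = algebraMap B F (Ideal.Quotient.mk P
      (MvPolynomial.aeval (Fin.cons u ℓ : Fin (r + 1) → MvPolynomial (Fin m) k) (V j))) := by
    intro j
    change algebraMap B F (θ (finSuccEquiv k r (V j))) = _
    rw [hcompat (V j)]
  have hρℓ : Ideal.Quotient.mk P (MvPolynomial.aeval ℓ ρ) ≠ 0 := by
    -- algebraic independence: `aeval (mk ∘ ℓ)` is injective
    have hinj := algebraicIndependent_iff_injective_aeval.mp hind
    have h1 : (MvPolynomial.aeval fun i => Ideal.Quotient.mk P (ℓ i)) ρ ≠ 0 := by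
      intro h0
      exact hρ (hinj (by rw [h0, map_zero]))
    have h2 : (MvPolynomial.aeval fun i => Ideal.Quotient.mk P (ℓ i)) ρ =
        Ideal.Quotient.mk P (MvPolynomial.aeval ℓ ρ) := by
      have : (MvPolynomial.aeval fun i => Ideal.Quotient.mk P (ℓ i)) =
          (Ideal.Quotient.mkₐ k P).comp (MvPolynomial.aeval ℓ) := by
        rw [MvPolynomial.comp_aeval]
        rfl
      rw [this]
      rfl
    rwa [h2] at h1
  have hφρ : φ (Polynomial.C ρ) ≠ 0 := by
    rw [hφC]
    exact fun h => hρℓ ((IsFractionRing.injective B F) (by rw [h, map_zero]))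
  -- the point `Ȳ ∈ F^m` satisfies `Ȳ_j φ(ρ) = φ(w_j)`
  set yF : Fin m → F := fun j => algebraMap B F (Ideal.Quotient.mk P (X j)) with hyF
  have hy : ∀ j, yF j * φ (Polynomial.C ρ) = φ (w j) := by
    intro j
    rw [hφC, hφw, ← map_mul, ← map_mul]
    congr 1
    rw [eq_comm, ← sub_eq_zero, ← map_sub, Ideal.Quotient.eq_zero_iff_mem]
    have := P.neg_mem (hV j)
    rwa [neg_sub, mul_comm] at this
  have hHF : φ H = 0 := by
    rw [hH, map_homog_eq_of_mul_eq φ ρ w g hφρ yF hy]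
    -- `g(Ȳ) = 0` in `F` since `g ∈ P`
    have hι : φ.comp (Polynomial.C.comp MvPolynomial.C) = algebraMap k F := by
      ext a
      change φ (Polynomial.C (MvPolynomial.C a)) = _
      rw [hφC, MvPolynomial.aeval_C, Ideal.Quotient.mk_algebraMap, ← IsScalarTower.algebraMap_apply]
    rw [hι]
    have hev : MvPolynomial.eval yF (MvPolynomial.map (algebraMap k F) g) =
        algebraMap B F (Ideal.Quotient.mk P g) := by
      rw [MvPolynomial.eval_map, ← MvPolynomial.aeval_def]
      have hΦ : (MvPolynomial.aeval yF : MvPolynomial (Fin m) k →ₐ[k] F) =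
          ((IsScalarTower.toAlgHom k B F).comp (Ideal.Quotient.mkₐ k P)).comp
            (MvPolynomial.aeval X) := by
        rw [MvPolynomial.comp_aeval]
        rfl
      rw [hΦ, MvPolynomial.aeval_X_left]
      rfl
    rw [hev, Ideal.Quotient.eq_zero_iff_mem.mpr hg, map_zero, mul_zero]
  -- (2) hence `H ∈ (Q)` : `θ H = 0`, i.e. `finSuccEquiv⁻¹ H ∈ P.comap (aeval (cons u ℓ)) = (Q)`
  have hθH : θ H = 0 := (IsFractionRing.injective B F) (by rw [map_zero]; exact hHF)
  have hHker : (finSuccEquiv k r).symm H ∈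
      P.comap (MvPolynomial.aeval (Fin.cons u ℓ : Fin (r + 1) → MvPolynomial (Fin m) k)) := by
    rw [Ideal.mem_comap, ← Ideal.Quotient.eq_zero_iff_mem, ← hcompat, AlgEquiv.apply_symm_apply]
    exact hθH
  rw [comap_aeval_cons_eq_span_singleton_of_leadingCoeff_eq_C P ℓ u hind Q hc hlc hirr hroot,
    Ideal.mem_span_singleton] at hHker
  have hdvd : finSuccEquiv k r Q ∣ H := by
    have := map_dvd (finSuccEquiv k r) hHker
    rwa [AlgEquiv.apply_symm_apply] at this
  -- (3) evaluate at `x`: `H(x) = 0` and divide out `ρ(x')^N`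
  let ψ : (MvPolynomial (Fin r) k)[X] →+* L :=
    (Polynomial.aevalTower (MvPolynomial.aeval (x ∘ Fin.succ) : MvPolynomial (Fin r) k →ₐ[k] L)
      (x 0)).toRingHom
  have hψQ : ψ (finSuccEquiv k r Q) = 0 := by
    change Polynomial.aevalTower _ _ _ = 0
    rw [aevalTower_finSuccEquiv, hQx]
  have hψH : ψ H = 0 := by
    obtain ⟨t, ht⟩ := hdvd
    rw [ht, map_mul, hψQ, zero_mul]
  have hψρ : ψ (Polynomial.C ρ) = MvPolynomial.aeval (x ∘ Fin.succ) ρ := by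
    change Polynomial.aevalTower _ _ _ = _
    rw [Polynomial.aevalTower_C]
  have hψρ0 : ψ (Polynomial.C ρ) ≠ 0 := by rw [hψρ]; exact hρx
  have hψw : ∀ j, ψ (w j) = MvPolynomial.aeval x (V j) := by
    intro j
    change Polynomial.aevalTower _ _ _ = _
    rw [aevalTower_finSuccEquiv]
  have key := map_homog_eq ψ ρ w g hψρ0
  have hι : ψ.comp (Polynomial.C.comp MvPolynomial.C) = algebraMap k L := by
    ext a
    change Polynomial.aevalTower _ _ (Polynomial.C (MvPolynomial.C a)) = _
    rw [Polynomial.aevalTower_C, MvPolynomial.algHom_C]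
  have hpt : (fun j => ψ (w j) / ψ (Polynomial.C ρ)) =
      fun j => MvPolynomial.aeval x (V j) / MvPolynomial.aeval (x ∘ Fin.succ) ρ := by
    funext j
    rw [hψw, hψρ]
  rw [← hH, hψH, hι, hpt, MvPolynomial.eval_map] at key
  rw [MvPolynomial.aeval_def]
  exact (mul_eq_zero.mp key.symm).resolve_left (pow_ne_zero _ hψρ0)

/-- **The point conjunct of `TameResolution` for a system.** With the data above and a system
`S : Fin t → k[Y]` with every `S i ∈ P` (e.g. `P` a minimal prime over `(S)`): every zero `x` of
`Q` over a field `L ⊇ k` with `ρ(x ∘ succ) ≠ 0` yields the common zero `V(x)/ρ(x ∘ succ)` of `S`. -/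
theorem forall_aeval_div_eq_zero_of_congruence (P : Ideal (MvPolynomial (Fin m) k)) [P.IsPrime]
    (ℓ : Fin r → MvPolynomial (Fin m) k) (u : MvPolynomial (Fin m) k)
    (hind : AlgebraicIndependent k fun i => Ideal.Quotient.mk P (ℓ i))
    (Q : MvPolynomial (Fin (r + 1)) k) {c : k} (hc : c ≠ 0)
    (hlc : (finSuccEquiv k r Q).leadingCoeff = MvPolynomial.C c) (hirr : Irreducible Q)
    (hroot : MvPolynomial.aeval (Fin.cons u ℓ : Fin (r + 1) → MvPolynomial (Fin m) k) Q ∈ P)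
    (ρ : MvPolynomial (Fin r) k) (hρ : ρ ≠ 0) (V : Fin m → MvPolynomial (Fin (r + 1)) k)
    (hV : ∀ j, MvPolynomial.aeval ℓ ρ * X j -
      MvPolynomial.aeval (Fin.cons u ℓ : Fin (r + 1) → MvPolynomial (Fin m) k) (V j) ∈ P)
    {t : ℕ} (S : Fin t → MvPolynomial (Fin m) k) (hS : ∀ i, S i ∈ P)
    {L : Type*} [Field L] [Algebra k L] (x : Fin (r + 1) → L)
    (hQx : MvPolynomial.aeval x Q = 0) (hρx : MvPolynomial.aeval (x ∘ Fin.succ) ρ ≠ 0) (i : Fin t) :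
    MvPolynomial.aeval (fun j => MvPolynomial.aeval x (V j) / MvPolynomial.aeval (x ∘ Fin.succ) ρ)
      (S i) = 0 :=
  aeval_div_eq_zero_of_congruence P ℓ u hind Q hc hlc hirr hroot ρ hρ V hV (hS i) x hQx hρx

/-- Minimal primes contain the generators: if `𝔭` is a minimal prime over `(S)` then every
`S i ∈ 𝔭` (so the previous theorem applies to the route's `𝔭 ∈ (Ideal.span (range S)).minimalPrimes`). -/
theorem mem_of_mem_minimalPrimes_span_range {R : Type*} [CommRing R] {t : ℕ} (S : Fin t → R)
    {𝔭 : Ideal R} (h𝔭 : 𝔭 ∈ (Ideal.span (Set.range S)).minimalPrimes) (i : Fin t) : S i ∈ 𝔭 :=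
  h𝔭.1.2 (Ideal.subset_span (Set.mem_range_self i))

end Points

/-! ## Integer data read over `ℚ` and over `ℚ̄` -/

section IntData

variable {m r : ℕ}

/-- `ℤ`-evaluation over a `ℚ`-algebra is `ℚ`-evaluation of the mapped polynomial (for ANY
`ℤ`-algebra structure on the target: the instance is a hypothesis so that the lemma rewrites the
route's literal terms). -/
theorem aeval_map_intCast {n : ℕ} {L : Type*} [CommRing L] [Algebra ℚ L] [Algebra ℤ L]
    (y : Fin n → L) (p : MvPolynomial (Fin n) ℤ) :
    MvPolynomial.aeval y (MvPolynomial.map (Int.castRingHom ℚ) p) = MvPolynomial.aeval y p := by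
  induction p using MvPolynomial.induction_on with
  | C a =>
    simp only [eq_intCast, map_intCast]
  | add p q hp hq => rw [map_add, map_add, map_add, hp, hq]
  | mul_X p i hp =>
    rw [map_mul, MvPolynomial.map_X, map_mul, map_mul, hp, MvPolynomial.aeval_X,
      MvPolynomial.aeval_X]

/-- The leading-coefficient shape `(finSuccEquiv ℤ r Q).leadingCoeff = C cQ` read over `ℚ`. -/
theorem leadingCoeff_finSuccEquiv_map_int (Q : MvPolynomial (Fin (r + 1)) ℤ) (cQ : ℤ)
    (hlc : (finSuccEquiv ℤ r Q).leadingCoeff = MvPolynomial.C cQ) :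
    (finSuccEquiv ℚ r (MvPolynomial.map (Int.castRingHom ℚ) Q)).leadingCoeff =
      MvPolynomial.C (cQ : ℚ) := by
  rw [Literature.AlgebraicGeometry.Motives.TwoPointPencil.finSuccEquiv_map,
    Polynomial.leadingCoeff_map_of_injective
      (MvPolynomial.map_injective _ (Int.castRingHom ℚ).injective_int), hlc,
    MvPolynomial.map_C, eq_intCast]

/-- **(points) for integer data.** For a prime `𝔭 ⊆ ℚ[Y₁..Y_m]`, `ℓ` algebraically independent
modulo `𝔭`, `u`, an integer model `Q` (`lc = C cQ`, `cQ ≠ 0`, `Q^ℚ` irreducible, `Q(u, ℓ) ∈ 𝔭`),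
`ρ ∈ ℤ[X₁..X_r] ∖ 0`, `V : Fin m → ℤ[X₀..X_r]` with the congruences `ρ(ℓ)·Y_j - V_j(u, ℓ) ∈ 𝔭`
(read over `ℚ`), and integer polynomials `S i` with `S i^ℚ ∈ 𝔭`: every `ℚ̄`-zero `x` of `Q` with
`ρ(x ∘ succ) ≠ 0` is mapped by `V/ρ` to a common zero of the `S i`. -/
theorem forall_aeval_div_eq_zero_int (𝔭 : Ideal (MvPolynomial (Fin m) ℚ)) [𝔭.IsPrime]
    (ℓ : Fin r → MvPolynomial (Fin m) ℚ) (u : MvPolynomial (Fin m) ℚ)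
    (hind : AlgebraicIndependent ℚ fun i => Ideal.Quotient.mk 𝔭 (ℓ i))
    (Q : MvPolynomial (Fin (r + 1)) ℤ) (cQ : ℤ) (hcQ : cQ ≠ 0)
    (hlc : (finSuccEquiv ℤ r Q).leadingCoeff = MvPolynomial.C cQ)
    (hirr : Irreducible (MvPolynomial.map (Int.castRingHom ℚ) Q))
    (hroot : MvPolynomial.aeval (Fin.cons u ℓ : Fin (r + 1) → MvPolynomial (Fin m) ℚ)
      (MvPolynomial.map (Int.castRingHom ℚ) Q) ∈ 𝔭)
    (ρ : MvPolynomial (Fin r) ℤ) (hρ : ρ ≠ 0) (V : Fin m → MvPolynomial (Fin (r + 1)) ℤ)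
    (hV : ∀ j, MvPolynomial.aeval ℓ (MvPolynomial.map (Int.castRingHom ℚ) ρ) * X j -
      MvPolynomial.aeval (Fin.cons u ℓ : Fin (r + 1) → MvPolynomial (Fin m) ℚ)
        (MvPolynomial.map (Int.castRingHom ℚ) (V j)) ∈ 𝔭)
    {t : ℕ} (S : Fin t → MvPolynomial (Fin m) ℤ)
    (hS : ∀ i, MvPolynomial.map (Int.castRingHom ℚ) (S i) ∈ 𝔭) :
    ∀ x : Fin (r + 1) → AlgebraicClosure ℚ, MvPolynomial.aeval x Q = 0 →
      MvPolynomial.aeval (x ∘ Fin.succ) ρ ≠ 0 →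
      ∀ i, MvPolynomial.aeval (fun j => MvPolynomial.aeval x (V j) / MvPolynomial.aeval (x ∘ Fin.succ) ρ)
        (S i) = 0 := by
  intro x hQx hρx i
  have hρℚ : MvPolynomial.map (Int.castRingHom ℚ) ρ ≠ 0 := fun h =>
    hρ (MvPolynomial.map_injective _ (Int.castRingHom ℚ).injective_int (by rw [h, map_zero]))
  have hQx' : MvPolynomial.aeval x (MvPolynomial.map (Int.castRingHom ℚ) Q) = 0 := by
    rw [aeval_map_intCast]; exact hQx
  have hρx' : MvPolynomial.aeval (x ∘ Fin.succ) (MvPolynomial.map (Int.castRingHom ℚ) ρ) ≠ 0 := by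
    rw [aeval_map_intCast]; exact hρx
  have key := aeval_div_eq_zero_of_congruence 𝔭 ℓ u hind
    (MvPolynomial.map (Int.castRingHom ℚ) Q) (c := (cQ : ℚ)) (Int.cast_ne_zero.mpr hcQ)
    (leadingCoeff_finSuccEquiv_map_int Q cQ hlc) hirr hroot (MvPolynomial.map (Int.castRingHom ℚ) ρ)
    hρℚ (fun j => MvPolynomial.map (Int.castRingHom ℚ) (V j)) hV (hS i) x hQx' hρx'
  simpa only [aeval_map_intCast] using key

end IntData


end Summit.ValiantsHypothesis.ValiantsHypothesis.Theorems.LangWeilTransfer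

end
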